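import Summits.Ventures.PackingBounds.Energy.FivePointCubicSquares
import HarnessLib

/-!
# Five points on `S²`, the energy `Σ (1 + ⟪x,y⟫)^3`: nonnegativity and the sum-of-squares identity of the certificate

Framing: lottery ticket; floor = certified bounds/negative ranges. Venture `PackingBounds`, cell
`pub-packcert`, energy family E3PT (pub-packcert-energy gen 10).
-/

noncomputable section

namespace Summit.Ventures.PackingBounds.Energy.FivePointCubic

set_option maxRecDepth 20000 in
/-- The chunk `FivePointCubic.sqPart0` is a nonnegative combination of squares. -/
theorem cubic_sqPart0_nonneg (u v t : ℝ) : 0 ≤ FivePointCubic.sqPart0 u v t := by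
  unfold FivePointCubic.sqPart0; positivity

set_option maxRecDepth 20000 in
/-- The chunk `FivePointCubic.sqPart1` is a nonnegative combination of squares. -/
theorem cubic_sqPart1_nonneg (u v t : ℝ) : 0 ≤ FivePointCubic.sqPart1 u v t := by
  unfold FivePointCubic.sqPart1; positivity

set_option maxRecDepth 20000 in
/-- The chunk `FivePointCubic.sqPart2` is a nonnegative combination of squares. -/
theorem cubic_sqPart2_nonneg (u v t : ℝ) : 0 ≤ FivePointCubic.sqPart2 u v t := by
  unfold FivePointCubic.sqPart2; positivity

set_option maxRecDepth 20000 in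
/-- The chunk `FivePointCubic.sqPart3` is a nonnegative combination of squares. -/
theorem cubic_sqPart3_nonneg (u v t : ℝ) : 0 ≤ FivePointCubic.sqPart3 u v t := by
  unfold FivePointCubic.sqPart3; positivity

set_option maxRecDepth 20000 in
/-- The chunk `FivePointCubic.prPart0` is a nonnegative combination of squares. -/
theorem cubic_prPart0_nonneg (u v t : ℝ) : 0 ≤ FivePointCubic.prPart0 u v t := by
  unfold FivePointCubic.prPart0; positivity

set_option maxRecDepth 20000 in
/-- The chunk `FivePointCubic.prPart1` is a nonnegative combination of squares. -/
theorem cubic_prPart1_nonneg (u v t : ℝ) : 0 ≤ FivePointCubic.prPart1 u v t := by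
  unfold FivePointCubic.prPart1; positivity

set_option maxRecDepth 20000 in
/-- The chunk `FivePointCubic.prPart2` is a nonnegative combination of squares. -/
theorem cubic_prPart2_nonneg (u v t : ℝ) : 0 ≤ FivePointCubic.prPart2 u v t := by
  unfold FivePointCubic.prPart2; positivity

set_option maxRecDepth 20000 in
/-- The chunk `FivePointCubic.prPart3` is a nonnegative combination of squares. -/
theorem cubic_prPart3_nonneg (u v t : ℝ) : 0 ≤ FivePointCubic.prPart3 u v t := by
  unfold FivePointCubic.prPart3; positivity

set_option maxRecDepth 20000 in
/-- The chunk `FivePointCubic.prPart4` is a nonnegative combination of squares. -/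
theorem cubic_prPart4_nonneg (u v t : ℝ) : 0 ≤ FivePointCubic.prPart4 u v t := by
  unfold FivePointCubic.prPart4; positivity

set_option maxRecDepth 20000 in
/-- The chunk `FivePointCubic.prPart5` is a nonnegative combination of squares. -/
theorem cubic_prPart5_nonneg (u v t : ℝ) : 0 ≤ FivePointCubic.prPart5 u v t := by
  unfold FivePointCubic.prPart5; positivity

set_option maxRecDepth 20000 in
/-- The chunk `FivePointCubic.prPart6` is a nonnegative combination of squares. -/
theorem cubic_prPart6_nonneg (u v t : ℝ) : 0 ≤ FivePointCubic.prPart6 u v t := by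
  unfold FivePointCubic.prPart6; positivity

set_option maxRecDepth 20000 in
/-- The chunk `FivePointCubic.prPart7` is a nonnegative combination of squares. -/
theorem cubic_prPart7_nonneg (u v t : ℝ) : 0 ≤ FivePointCubic.prPart7 u v t := by
  unfold FivePointCubic.prPart7; positivity

set_option maxRecDepth 20000 in
/-- The chunk `FivePointCubic.prPart8` is a nonnegative combination of squares. -/
theorem cubic_prPart8_nonneg (u v t : ℝ) : 0 ≤ FivePointCubic.prPart8 u v t := by
  unfold FivePointCubic.prPart8; positivity

set_option maxRecDepth 20000 in
/-- The chunk `FivePointCubic.dgPart` is a nonnegative combination of squares. -/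
theorem cubic_dgPart_nonneg (u v t : ℝ) : 0 ≤ FivePointCubic.dgPart u v t := by
  unfold FivePointCubic.dgPart; positivity

/-- The slack polynomial is nonnegative everywhere (it is a weighted sum of squares). -/
theorem cubic_sosR_nonneg (u v t : ℝ) : 0 ≤ FivePointCubic.sosR u v t := by
  unfold FivePointCubic.sosR
  linarith [cubic_sqPart0_nonneg u v t, cubic_sqPart1_nonneg u v t, cubic_sqPart2_nonneg u v t, cubic_sqPart3_nonneg u v t, cubic_prPart0_nonneg u v t, cubic_prPart1_nonneg u v t, cubic_prPart2_nonneg u v t, cubic_prPart3_nonneg u v t, cubic_prPart4_nonneg u v t, cubic_prPart5_nonneg u v t, cubic_prPart6_nonneg u v t, cubic_prPart7_nonneg u v t, cubic_prPart8_nonneg u v t, cubic_dgPart_nonneg u v t]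

set_option maxRecDepth 20000 in
set_option maxHeartbeats 400000000 in
/-- The sum-of-squares identity of the certificate: the slack of the three-point inequality is `FivePointCubic.sosR`. -/
theorem cubic_sos_identity (u v t : ℝ) :
    (FivePointCubic.pmin u + FivePointCubic.pmin v + FivePointCubic.pmin t) / 3 - (FivePointCubic.c0 + 3 * FivePointCubic.Fexp u v t + FivePointCubic.Fexp u u 1 + FivePointCubic.Fexp v v 1 + FivePointCubic.Fexp t t 1
      + (FivePointCubic.a1 * u + FivePointCubic.a1 * v + FivePointCubic.a1 * t) / 3) = FivePointCubic.sosR u v t := by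
  unfold FivePointCubic.pmin FivePointCubic.Fexp FivePointCubic.sosR FivePointCubic.c0 FivePointCubic.a1 FivePointCubic.sqPart0 FivePointCubic.sqPart1 FivePointCubic.sqPart2 FivePointCubic.sqPart3 FivePointCubic.prPart0 FivePointCubic.prPart1 FivePointCubic.prPart2 FivePointCubic.prPart3 FivePointCubic.prPart4 FivePointCubic.prPart5 FivePointCubic.prPart6 FivePointCubic.prPart7 FivePointCubic.prPart8 FivePointCubic.dgPart
  ring

end Summit.Ventures.PackingBounds.Energy.FivePointCubic
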